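import Summits.BirchSwinnertonDyer.BirchSwinnertonDyer.Theorems.OneSidedTwistSqueezeX9KatoDivisibilityX9LocalExponentPk
import Literature.NumberTheory.EllipticCurves.IwasawaTwistModPk
import HarnessLib

/-!
# Line `graded_euler_loss` of crux `KatoDivisibilityX9` (stmt-BirchSwinnertonDyer-20547), stub 1a' `stub_testCocyclePkLevelX9`,
# the local clause AT `p` — level-`p^k` engine, file 1 of 2 (CARRIER): on the `D ∩ Γ_∞`-fixed vectors `A ≤ 𝒯^{(k)}_L`,
# `S^b A ⊆ (d₀ − 1)A` for a topological generator `d₀ ∈ D` and `p^b ≥ #M^{D ∩ Γ_∞}`, uniformly in `L`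

Seat `bsd-line-k6-p4` (prover-bsd-line-k6-p4-g5-0, 5th LEAD on the crux).  THEOREMS ONLY — no definition, no named fact, no
`sorry`; credits nothing (`--supports … --as helper`).  In the v4 stub the test class `Ψ ∈ H¹(ℚ, 𝒯^{(d+1)}_L(E, κ⁻¹))` is built by
the Γ_∞-ROUTE (wave-2 worker files `…StubTestCocyclePkLevelX9InfRes*`, `…Kummer`); its clause «`loc_p(T^ε Ψ) = 0`» needs, at the
place above `p` (totally ramified in `K_∞`, so the decomposition group `D` contains a topological generator `d₀` of `κ`), a
mechanism turning «the cocycle of `Ψ` is principal on `D ∩ Γ_∞`» into «`loc_v (T^[b] Ψ) = 0`» with `b` INDEPENDENT of `L` and no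
Shapiro / corestriction (the level-`p` route `SelmerDual.localP_of` used both).  This file is the carrier half:
* §0 `twistModPk_apply_of_mem_kerSubgroup` (`Γ_∞` acts through `ρ`), `conj_mem_kerSubgroup`.
* §1 `exists_shiftEnd_pow_eq_sub_of_fixed` — `A := {x ∈ 𝒯^{(k)}_L : (D ⊓ ker κ) fixes x}` is stable under `S` and `d₀`; the
  endomorphism `d₀ − 1` of the finite group `A` has `#coker = #ker`; a `d₀`-fixed `x ∈ A` is determined by its top coordinate (a
  `(D ⊓ ker κ)`-fixed element of `M`), so `#ker ≤ p^b`; `S` is nilpotent on the `p^k`-torsion group `A/(d₀ − 1)A` of order `≤ p^b`,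
  hence `S^b = 0` there (`…LocalExponentPk.iterate_eq_zero_of_nilpotent_of_natCard_le_of_pow_smul`): **`S^b a = d₀a′ − a′` with
  `a′ ∈ A` for every `a ∈ A`.**
File 2 (`…LocalPEnginePk`) turns this into `loc_v (T^[b] [Φ]) = 0` for cocycles `Φ` principal on `D_v ⊓ ker κ`.  HONEST LABEL:
closes nothing; BSD is not proved by any of this; no summit statement is proved by this seat.
References: L. Washington, GTM 83 §13.1–13.2 [Washington1997]; J.-P. Serre, *Galois Cohomology* I §2.2 [SerreGaloisCohomology1997].
-/

set_option linter.dupNamespace false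
set_option autoImplicit false

noncomputable section

open scoped Classical ContRepresentation

universe u

namespace Summit.BirchSwinnertonDyer.BirchSwinnertonDyer.Theorems.OneSidedTwistSqueezeX9KatoDivisibilityX9LocalPCarrierPk

open Summit.BirchSwinnertonDyer.BirchSwinnertonDyer.Theorems.OneSidedTwistSqueezeX9KatoDivisibilityX9LocalExponentPk
open Function Field NumberField IsDedekindDomain
open Literature.NumberTheory.GaloisRepresentations
open Literature.NumberTheory.EllipticCurves

/-! ## §0 Two unfolding facts on `𝒯^{(k)}_L` -/

section Unfold

variable {K : Type u} [Field K] {M : Type u} [AddCommGroup M] [TopologicalSpace M] [DiscreteTopology M]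
  (ρ : DiscreteGaloisModule K M) {p : ℕ} [hp : Fact p.Prime] {k : ℕ} (hM : ∀ x : M, p ^ k • x = 0)
  (κ : ZpExtension K p) (L : ℕ)

/-- `Γ_∞ = ker κ` acts on `𝒯^{(k)}_L` through `ρ` alone (coordinatewise): the twist character is trivial there.
[cite: Washington1997, §13.1–§13.2] -/
theorem twistModPk_apply_of_mem_kerSubgroup {u : absoluteGaloisGroup K} (hu : u ∈ κ.kerSubgroup) (x : Fin L → M) :
    κ.twistModPk ρ hM L u x = fun i => ρ u (x i) := by
  have hL : L ≤ p ^ (L + k + 1 - k) := by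
    rw [show L + k + 1 - k = L + 1 by omega]
    exact (Nat.lt_pow_self hp.out.one_lt).le.trans (Nat.pow_le_pow_right hp.out.pos (Nat.le_succ L))
  exact ZpExtension.twistModPk_apply_of_mem_layerSubgroup κ ρ hM L hL (κ.kerSubgroup_le_layerSubgroup (L + k) hu) x

/-- `ker κ` is normalised by everything: `d⁻¹ u d ∈ ker κ` for `u ∈ ker κ`. [folklore] -/
theorem conj_mem_kerSubgroup {u : absoluteGaloisGroup K} (hu : u ∈ κ.kerSubgroup) (d : absoluteGaloisGroup K) :
    d⁻¹ * u * d ∈ κ.kerSubgroup := by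
  rw [ZpExtension.mem_kerSubgroup] at hu ⊢
  rw [map_mul, map_mul, map_inv, hu, mul_one, inv_mul_cancel]

end Unfold

/-! ## §1 The carrier statement: `S^b A ⊆ (d₀ − 1)A` on the `D ∩ Γ_∞`-fixed vectors `A` -/

section Carrier

variable {K : Type u} [Field K] {M : Type u} [AddCommGroup M] [TopologicalSpace M] [DiscreteTopology M] [Finite M]
  (ρ : DiscreteGaloisModule K M) {p : ℕ} [hp : Fact p.Prime] {k : ℕ} (hM : ∀ x : M, p ^ k • x = 0)
  (κ : ZpExtension K p) (L : ℕ)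

/-- **`S^b A ⊆ (d₀ − 1)A`.**  Let `D ≤ Γ_K` be a subgroup containing a topological generator `d₀` of `κ`, `D_∞ := D ⊓ ker κ`,
`A := {x ∈ 𝒯^{(k)}_L : D_∞ fixes x}`, and `p^b ≥ #{m ∈ M : D_∞ fixes m}`.  Then for every `a ∈ A` there is `a′ ∈ A` with
`S^b a = d₀·a′ − a′`.  (The endomorphism `d₀ − 1` of the finite group `A` has `#coker = #ker`; a `d₀`-fixed `x ∈ A` satisfies
`x_{i−1} = ρ(d₀)⁻¹x_i − x_i`, so is determined by its top coordinate, a `D_∞`-fixed element of `M`: `#ker ≤ p^b`; and `S` is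
nilpotent on the `p^k`-torsion group `A/(d₀ − 1)A` of order `≤ p^b`, so `S^b = 0` there — file 1's exponent lemma.)
[cite: Washington1997, §13.1–§13.2] [cite: SerreGaloisCohomology1997, I §2.2] -/
theorem exists_shiftEnd_pow_eq_sub_of_fixed (D : Subgroup (absoluteGaloisGroup K)) {d₀ : absoluteGaloisGroup K}
    (hd₀D : d₀ ∈ D) (hd₀ : κ.IsTopGenerator d₀) {b : ℕ}
    (hN₀ : Nat.card {m : M // ∀ u ∈ D ⊓ κ.kerSubgroup, ρ u m = m} ≤ p ^ b)
    (a : Fin L → M) (ha : ∀ u ∈ D ⊓ κ.kerSubgroup, κ.twistModPk ρ hM L u a = a) :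
    ∃ a' : Fin L → M, (∀ u ∈ D ⊓ κ.kerSubgroup, κ.twistModPk ρ hM L u a' = a') ∧
      (shiftEnd M L ^ b) a = κ.twistModPk ρ hM L d₀ a' - a' := by
  -- the level `L = 0` is trivial
  rcases Nat.eq_zero_or_pos L with hL0 | hLpos
  · subst hL0
    exact ⟨0, fun u _ => map_zero _, Subsingleton.elim _ _⟩
  set X := κ.twistModPk ρ hM L with hXdef
  -- `D_∞` is normalised by `d₀`
  have hconj : ∀ u ∈ D ⊓ κ.kerSubgroup, d₀⁻¹ * u * d₀ ∈ D ⊓ κ.kerSubgroup := fun u hu =>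
    ⟨D.mul_mem (D.mul_mem (D.inv_mem hd₀D) hu.1) hd₀D, conj_mem_kerSubgroup κ hu.2 d₀⟩
  -- the fixed vectors `A`
  let A : AddSubgroup (Fin L → M) :=
    { carrier := {x | ∀ u ∈ D ⊓ κ.kerSubgroup, X u x = x}
      add_mem' := fun {x y} hx hy u hu => by rw [map_add, hx u hu, hy u hu]
      zero_mem' := fun u _ => map_zero _
      neg_mem' := fun {x} hx u hu => by rw [map_neg, hx u hu] }
  have hmemA : ∀ {x}, x ∈ A ↔ ∀ u ∈ D ⊓ κ.kerSubgroup, X u x = x := fun {x} => Iff.rfl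
  -- `S` and `d₀` preserve `A`
  have hSmem : ∀ x : A, shiftEnd M L (x : Fin L → M) ∈ A := fun x u hu => by
    rw [← ZpExtension.shiftEnd_twistModPk_apply, x.2 u hu]
  have hdmem : ∀ x : A, X d₀ (x : Fin L → M) ∈ A := fun x u hu => by
    have h1 : X u (X d₀ (x : Fin L → M)) = X (u * d₀) (x : Fin L → M) := by
      rw [map_mul, Module.End.mul_apply]
    rw [h1, show u * d₀ = d₀ * (d₀⁻¹ * u * d₀) by group, map_mul, Module.End.mul_apply,
      x.2 _ (hconj u hu)]
  have hΘmem : ∀ x : A, X d₀ (x : Fin L → M) - x ∈ A := fun x => A.sub_mem (hdmem x) x.2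
  -- the two endomorphisms of `A`
  let SA : A →+ A :=
    { toFun := fun x => ⟨shiftEnd M L (x : Fin L → M), hSmem x⟩
      map_zero' := Subtype.ext (map_zero _)
      map_add' := fun x y => Subtype.ext (map_add _ _ _) }
  let Θ : A →+ A :=
    { toFun := fun x => ⟨X d₀ (x : Fin L → M) - x, hΘmem x⟩
      map_zero' := Subtype.ext (by simp)
      map_add' := fun x y => Subtype.ext (by
        simp only [AddSubgroup.coe_add, map_add]
        abel) }
  have hSA : ∀ x : A, ((SA x : A) : Fin L → M) = shiftEnd M L x := fun _ => rfl
  have hΘ : ∀ x : A, ((Θ x : A) : Fin L → M) = X d₀ (x : Fin L → M) - x := fun _ => rfl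
  -- they commute
  have hcomm : ∀ x : A, SA (Θ x) = Θ (SA x) := fun x => Subtype.ext (by
    rw [hSA, hΘ, hΘ, hSA, map_sub, ZpExtension.shiftEnd_twistModPk_apply])
  -- iterates of `SA`
  have hSA_iter : ∀ (j : ℕ) (x : A), ((SA^[j] x : A) : Fin L → M) = (shiftEnd M L ^ j) (x : Fin L → M) := by
    intro j
    induction j with
    | zero => intro x; rfl
    | succ j ih =>
      intro x
      rw [iterate_succ_apply', hSA, ih, pow_succ', Module.End.mul_apply]
  -- `S` on the cokernel `Q = A/(d₀ − 1)A`
  have hle : Θ.range ≤ Θ.range.comap SA := by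
    rintro _ ⟨x, rfl⟩
    exact ⟨SA x, (hcomm x).symm⟩
  let Sbar : A ⧸ Θ.range →+ A ⧸ Θ.range := QuotientAddGroup.map Θ.range Θ.range SA hle
  have hSbar_iter : ∀ (j : ℕ) (x : A), Sbar^[j] (QuotientAddGroup.mk' Θ.range x) =
      QuotientAddGroup.mk' Θ.range (SA^[j] x) := by
    intro j
    induction j with
    | zero => intro x; rfl
    | succ j ih =>
      intro x
      rw [iterate_succ_apply', iterate_succ_apply', ih]
      rfl
  -- `S̄` is nilpotent
  have hSbar_nil : ∀ z : A ⧸ Θ.range, Sbar^[L] z = 0 := by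
    intro z
    induction z using QuotientAddGroup.induction_on with
    | H x =>
      change Sbar^[L] (QuotientAddGroup.mk' Θ.range x) = 0
      rw [hSbar_iter]
      have hx0 : SA^[L] x = 0 := Subtype.ext (by
        rw [hSA_iter, shiftEnd_pow_eq_zero le_rfl, LinearMap.zero_apply, ZeroMemClass.coe_zero])
      rw [hx0, map_zero]
  -- `Q` is `p^k`-torsion
  have hApk : ∀ x : A, p ^ k • x = 0 := fun x => Subtype.ext (by
    rw [AddSubgroupClass.coe_nsmul, ZeroMemClass.coe_zero]
    funext i
    exact hM _)
  have hQpk : ∀ z : A ⧸ Θ.range, p ^ k • z = 0 := by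
    intro z
    induction z using QuotientAddGroup.induction_on with
    | H x => rw [← QuotientAddGroup.mk_nsmul, hApk, QuotientAddGroup.mk_zero]
  -- `#Q = #ker Θ ≤ #N₀ ≤ p^b`
  have hcardQ : Nat.card (A ⧸ Θ.range) = Nat.card Θ.ker := by
    have h1 := Θ.range.card_eq_card_quotient_mul_card_addSubgroup
    have h2 := Θ.ker.card_eq_card_quotient_mul_card_addSubgroup
    rw [Nat.card_congr (QuotientAddGroup.quotientKerEquivRange Θ).toEquiv, mul_comm] at h2
    exact Nat.eq_of_mul_eq_mul_right Nat.card_pos (h1.symm.trans h2)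
  -- a `d₀`-fixed vector of `A` with vanishing top coordinate vanishes
  have htop_lt : L - 1 < L := by omega
  have hzero : ∀ x : Fin L → M, x ∈ A → X d₀ x = x → x ⟨L - 1, htop_lt⟩ = 0 → x = 0 := by
    intro x _ hfix htop
    have hfix' : (1 + shiftEnd M L) (fun i => ρ d₀ (x i)) = x :=
      (ZpExtension.twistModPk_apply_of_isTopGenerator κ ρ hM L hd₀ x).symm.trans hfix
    -- coordinate `i`: `x_i = ρ(d₀)x_i + ρ(d₀)x_{i−1}` (`i ≥ 1`)
    have hcoord : ∀ i : Fin L, (i : ℕ) ≠ 0 →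
        x i = ρ d₀ (x i) + ρ d₀ (x ⟨(i : ℕ) - 1, by omega⟩) := by
      intro i hi
      have h := congrFun hfix' i
      rw [LinearMap.add_apply, Module.End.one_apply, Pi.add_apply, shiftEnd_apply, dif_neg hi] at h
      exact h.symm
    -- downward induction from the top coordinate
    have hdown : ∀ n : ℕ, ∀ i : Fin L, (i : ℕ) + n = L - 1 → x i = 0 := by
      intro n
      induction n with
      | zero =>
        intro i hi
        have : i = ⟨L - 1, htop_lt⟩ := Fin.ext (by simpa using hi)
        rw [this]
        exact htop
      | succ n ih =>
        intro i hi
        have hi' : ((⟨(i : ℕ) + 1, by omega⟩ : Fin L) : ℕ) + n = L - 1 := by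
          change (i : ℕ) + 1 + n = L - 1
          omega
        have h0 := ih ⟨(i : ℕ) + 1, by omega⟩ hi'
        have h1 := hcoord ⟨(i : ℕ) + 1, by omega⟩ (Nat.succ_ne_zero _)
        rw [h0, map_zero, zero_add] at h1
        have h2 : (⟨(i : ℕ) + 1 - 1, by omega⟩ : Fin L) = i := Fin.ext (by simp)
        rw [h2] at h1
        -- `ρ(d₀) (x i) = 0` forces `x i = 0`
        have h3 : x i = ρ d₀⁻¹ (ρ d₀ (x i)) := by
          rw [← Module.End.mul_apply, ← map_mul, inv_mul_cancel, map_one, Module.End.one_apply]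
        rw [h3, ← h1, map_zero]
    funext i
    exact hdown (L - 1 - (i : ℕ)) i (by omega)
  -- hence `ker Θ ↪ N₀` by the top coordinate
  have hker_le : Nat.card Θ.ker ≤ p ^ b := by
    refine le_trans (Nat.card_le_card_of_injective
      (fun x : Θ.ker => (⟨((x : A) : Fin L → M) ⟨L - 1, htop_lt⟩, fun u hu => ?_⟩ :
        {m : M // ∀ u ∈ D ⊓ κ.kerSubgroup, ρ u m = m})) ?_) hN₀
    · have h := (x : A).2 u hu
      rw [twistModPk_apply_of_mem_kerSubgroup ρ hM κ L hu.2] at h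
      exact congrFun h ⟨L - 1, htop_lt⟩
    · intro x y hxy
      have hxy' : ((x : A) : Fin L → M) ⟨L - 1, htop_lt⟩ = ((y : A) : Fin L → M) ⟨L - 1, htop_lt⟩ :=
        congrArg Subtype.val hxy
      have hx : X d₀ ((x : A) : Fin L → M) - (x : A) = 0 := by
        have := congrArg (fun z : A => (z : Fin L → M)) (show Θ x = 0 from x.2)
        exact this
      have hy : X d₀ ((y : A) : Fin L → M) - (y : A) = 0 := by
        have := congrArg (fun z : A => (z : Fin L → M)) (show Θ y = 0 from y.2)
        exact this
      have hsub : ((x : A) : Fin L → M) - (y : A) = 0 := by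
        refine hzero _ (A.sub_mem (x : A).2 (y : A).2) ?_ ?_
        · rw [sub_eq_zero] at hx hy
          rw [map_sub, hx, hy]
        · rw [Pi.sub_apply, hxy', sub_self]
      exact Subtype.ext (Subtype.ext (sub_eq_zero.1 hsub))
  have hQcard : Nat.card (A ⧸ Θ.range) ≤ p ^ b := hcardQ ▸ hker_le
  -- file 1's exponent lemma: `S̄^[b] = 0` on `Q`
  have hkill := iterate_eq_zero_of_nilpotent_of_natCard_le_of_pow_smul k (A ⧸ Θ.range) hQpk Sbar L hSbar_nil b
    hQcard (QuotientAddGroup.mk' Θ.range ⟨a, ha⟩)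
  rw [hSbar_iter] at hkill
  obtain ⟨x, hx⟩ := (QuotientAddGroup.eq_zero_iff _).1 hkill
  refine ⟨(x : Fin L → M), x.2, ?_⟩
  have h := congrArg (fun z : A => (z : Fin L → M)) hx
  simp only [hΘ, hSA_iter] at h
  exact h.symm

end Carrier

end Summit.BirchSwinnertonDyer.BirchSwinnertonDyer.Theorems.OneSidedTwistSqueezeX9KatoDivisibilityX9LocalPCarrierPk

end
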